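import Mathlib
import Literature.NumberTheory.LFunctions.FeketePolynomial
import Summits.ValiantsHypothesis.ValiantsHypothesis.Theses.FeketeSOS
import Summits.ValiantsHypothesis.ValiantsHypothesis.Theorems.FeketeSOSFeketeNoSparseSplitCharPFewnomial
import Summits.ValiantsHypothesis.ValiantsHypothesis.Theorems.FeketeSOSFeketeNoSparseSplitFeketeModPOrder

/-!
# FeketeSOS — `CharPSOSOrderDichotomy` (item stmt-ValiantsHypothesis-14991)

The fat-or-cancel dichotomy at the place over `p`.  Let `K` be a field of characteristic `p ≠ 2` and
suppose `X^p − 1 ∣ Σ_{i<s} c_i g_i² − F̄_p` with `deg g_i < p`, where `F̄_p = Σ_{m<p} (m|p) X^m` is the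
Fekete polynomial read in `K`.  Call a square *live* if `c_i ≠ 0` and `g_i ≠ 0`, and let `m` be the least
`(X−1)`-order `ord₁ g_i = rootMultiplicity 1 (g i)` of a live square.  Then either `2m ≥ (p−1)/2`, and the
live square attaining `m` has at least `m + 1 ≥ (p+3)/4` monomials by the char-`p` fewnomial (Hajós) bound
`cpf_main`; or `2m < (p−1)/2`, and since `X^p − 1 = (X−1)^p` and `(X−1)^{(p−1)/2} ∣ F̄_p`
(`stub_feketeModPOrder`), `(X−1)^{2m+1}` divides `Σ c_i g_i² = (X−1)^{2m} · Σ c_i h_i²` with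
`h_i = g_i /ₘ (X−1)^m`; cancelling `(X−1)^{2m}` in the domain `K[X]` and evaluating at `1` gives
`Σ_{i live, ord₁ g_i = m} c_i h_i(1)² = 0` (the `h_i` with `ord₁ g_i > m` vanish at `1`).  Live squares
exist because `F̄_p ≠ 0` has degree `< p`.  Folklore bookkeeping over the two landed stubs.
-/

-- `Summit.ValiantsHypothesis.ValiantsHypothesis.…` is the tree's mandated single-conjunct layout
-- (Sub = Summit), so the duplicated namespace component is intended.
set_option linter.dupNamespace false

namespace Summit.ValiantsHypothesis.ValiantsHypothesis.Theorems

open Polynomial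
open Literature.NumberTheory.LFunctions
open Summit.ValiantsHypothesis.ValiantsHypothesis.Theorems.FeketeNoSparseSplitCyclic

/-- **CharPSOSOrderDichotomy** (item stmt-ValiantsHypothesis-14991 of route FeketeSOS): over a field
`K` of characteristic `p ≠ 2`, if `X^p − 1 ∣ Σ_{i<s} c_i g_i² − F̄_p` with `deg g_i < p`, then either some
live square (`c_i ≠ 0`) has at least `(p+3)/4` monomials, or the minimal `(X−1)`-order `m` among the live
squares satisfies `2m < (p−1)/2` and the leading coefficients cancel:
`Σ_{i live, ord₁ g_i = m} c_i · (g_i /ₘ (X−1)^m)(1)² = 0`. -/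
theorem charPSOSOrderDichotomy_proof :
    Summit.ValiantsHypothesis.ValiantsHypothesis.Theses.FeketeSOS.CharPSOSOrderDichotomy := by
  unfold Summit.ValiantsHypothesis.ValiantsHypothesis.Theses.FeketeSOS.CharPSOSOrderDichotomy
  intro K _ p _ _ hp2 s c g hdeg hdvd
  classical
  have hp : p.Prime := Fact.out
  have hp1 : 1 < p := hp.one_lt
  -- The Fekete polynomial read in `K`.
  obtain ⟨Fm, hFm_def⟩ :
      ∃ F : K[X], (feketePolynomial p).map (Int.castRingHom K) = F := ⟨_, rfl⟩
  have hFm : Fm = ∑ m ∈ Finset.range p,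
      Polynomial.C ((legendreSym p m : ℤ) : K) * Polynomial.X ^ m := by
    rw [← hFm_def]
    simp only [map_feketePolynomial, eq_intCast]
  rw [← hFm] at hdvd
  have hFm0 : Fm ≠ 0 := by
    rw [← hFm_def]
    exact fmo_map_feketePolynomial_ne_zero p
  have hFmdeg : Fm.natDegree < p := by
    rw [← hFm_def]
    refine lt_of_le_of_lt natDegree_map_le ?_
    rw [natDegree_feketePolynomial]
    omega
  have hFmord : (X - C (1 : K)) ^ ((p - 1) / 2) ∣ Fm := by
    rw [← hFm_def]
    exact (le_rootMultiplicity_iff (fmo_map_feketePolynomial_ne_zero p)).1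
      (stub_feketeModPOrder K p hp2)
  -- Frobenius: `X ^ p - 1 = (X - 1) ^ p`.
  have hXp : (X - C (1 : K)) ^ p = X ^ p - 1 := by
    rw [sub_pow_char, ← C_pow, one_pow, C_1]
  rw [← hXp] at hdvd
  -- The live squares.
  obtain ⟨L, hL_def⟩ :
      ∃ L : Finset (Fin s), Finset.univ.filter (fun i => c i ≠ 0 ∧ g i ≠ 0) = L := ⟨_, rfl⟩
  have hmemL : ∀ i, i ∈ L ↔ c i ≠ 0 ∧ g i ≠ 0 := fun i => by
    rw [← hL_def, Finset.mem_filter]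
    exact ⟨fun h => h.2, fun h => ⟨Finset.mem_univ _, h⟩⟩
  -- There is a live square: otherwise `(X - 1) ^ p ∣ F̄_p ≠ 0` although `deg F̄_p < p`.
  have hLne : L.Nonempty := by
    by_contra hLne
    have hS0 : (∑ i, C (c i) * g i ^ 2) = 0 := by
      refine Finset.sum_eq_zero fun i _ => ?_
      by_cases hc : c i = 0
      · rw [hc, C_0, zero_mul]
      · by_cases hg : g i = 0
        · rw [hg, zero_pow two_ne_zero, mul_zero]
        · exact (hLne ⟨i, (hmemL i).2 ⟨hc, hg⟩⟩).elim
    rw [hS0, zero_sub, dvd_neg] at hdvd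
    have h1 := natDegree_le_of_dvd hdvd hFm0
    rw [(monic_X_sub_C (1 : K)).natDegree_pow, natDegree_X_sub_C, mul_one] at h1
    omega
  -- The minimal order `m`, attained at the live index `i₀`.
  obtain ⟨i₀, hi₀L, hmin⟩ := L.exists_min_image (fun i => (g i).rootMultiplicity 1) hLne
  obtain ⟨hc₀, hg₀⟩ := (hmemL i₀).1 hi₀L
  obtain ⟨m, hm⟩ : ∃ m : ℕ, (g i₀).rootMultiplicity 1 = m := ⟨_, rfl⟩
  have hmin' : ∀ i, c i ≠ 0 → g i ≠ 0 → m ≤ (g i).rootMultiplicity 1 :=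
    fun i hc hg => hm.ge.trans (hmin i ((hmemL i).2 ⟨hc, hg⟩))
  by_cases hfat : (p - 1) / 2 ≤ 2 * m
  · -- Fat branch: the square attaining `m` has `≥ m + 1 ≥ (p+3)/4` monomials.
    left
    refine ⟨i₀, hc₀, ?_⟩
    have hcard : m + 1 ≤ (g i₀).support.card :=
      cpf_main K p m (g i₀) hg₀ (hdeg i₀) ((le_rootMultiplicity_iff hg₀).1 hm.ge)
    omega
  · -- Cancelling branch.
    right
    rw [not_le] at hfat
    refine ⟨m, hfat, hmin', ⟨i₀, hc₀, hg₀, hm⟩, ?_⟩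
    have hDmonic : ((X - C (1 : K)) ^ m).Monic := (monic_X_sub_C (1 : K)).pow m
    have hD0 : ((X - C (1 : K)) ^ m) ^ 2 ≠ 0 := pow_ne_zero 2 hDmonic.ne_zero
    -- `g i = (X - 1)^m * (g i /ₘ (X - 1)^m)` for live `i`.
    have hfacg : ∀ i, c i ≠ 0 → g i ≠ 0 →
        (X - C (1 : K)) ^ m * (g i /ₘ (X - C (1 : K)) ^ m) = g i := fun i hc hg => by
      have hDg : (X - C (1 : K)) ^ m ∣ g i :=
        (pow_dvd_pow _ (hmin' i hc hg)).trans (pow_rootMultiplicity_dvd (g i) 1)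
      have h := modByMonic_add_div (g i) ((X - C (1 : K)) ^ m)
      rwa [(modByMonic_eq_zero_iff_dvd hDmonic).2 hDg, zero_add] at h
    -- Termwise factorisation `c_i g_i² = (X - 1)^{2m} · c_i (g_i /ₘ (X - 1)^m)²` (trivial for dead squares).
    have hfac : ∀ i, C (c i) * g i ^ 2
        = ((X - C (1 : K)) ^ m) ^ 2 * (C (c i) * (g i /ₘ (X - C (1 : K)) ^ m) ^ 2) := fun i => by
      by_cases hc : c i = 0
      · rw [hc, C_0, zero_mul, zero_mul, mul_zero]
      · by_cases hg : g i = 0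
        · rw [hg, zero_divByMonic, zero_pow two_ne_zero, mul_zero, mul_zero]
        · calc C (c i) * g i ^ 2
              = C (c i) * ((X - C (1 : K)) ^ m * (g i /ₘ (X - C (1 : K)) ^ m)) ^ 2 := by
                rw [hfacg i hc hg]
            _ = ((X - C (1 : K)) ^ m) ^ 2 * (C (c i) * (g i /ₘ (X - C (1 : K)) ^ m) ^ 2) := by
                ring
    have hS : (∑ i, C (c i) * g i ^ 2)
        = ((X - C (1 : K)) ^ m) ^ 2 * ∑ i, C (c i) * (g i /ₘ (X - C (1 : K)) ^ m) ^ 2 := by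
      rw [Finset.mul_sum]
      exact Finset.sum_congr rfl fun i _ => hfac i
    -- `(X - 1) ^ (2m+1)` divides the sum of squares.
    have h2m1 : 2 * m + 1 ≤ (p - 1) / 2 := by omega
    have h2m1p : 2 * m + 1 ≤ p := by omega
    have hdvdS : (X - C (1 : K)) ^ (2 * m + 1) ∣ ∑ i, C (c i) * g i ^ 2 := by
      have h1 : (X - C (1 : K)) ^ (2 * m + 1) ∣ (∑ i, C (c i) * g i ^ 2) - Fm :=
        (pow_dvd_pow _ h2m1p).trans hdvd
      have h2 : (X - C (1 : K)) ^ (2 * m + 1) ∣ Fm := (pow_dvd_pow _ h2m1).trans hFmord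
      simpa only [sub_add_cancel] using dvd_add h1 h2
    have hpow : (X - C (1 : K)) ^ (2 * m + 1) = ((X - C (1 : K)) ^ m) ^ 2 * (X - C 1) := by
      rw [pow_succ (X - C (1 : K)) (2 * m), pow_mul' (X - C (1 : K)) 2 m]
    rw [hpow, hS, mul_dvd_mul_iff_left hD0, dvd_iff_isRoot] at hdvdS
    -- Evaluate the quotient at `1`.
    have hQ : ∑ i, c i * ((g i /ₘ (X - C (1 : K)) ^ m).eval 1) ^ 2 = 0 := by
      have h := hdvdS.eq_zero
      simpa only [eval_finsetSum, eval_mul, eval_C, eval_pow] using h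
    -- Only the live squares of order exactly `m` contribute.
    refine (Finset.sum_subset (Finset.subset_univ _) fun i _ hi => ?_).trans hQ
    by_cases hc : c i = 0
    · rw [hc, zero_mul]
    · by_cases hg : g i = 0
      · rw [hg, zero_divByMonic, eval_zero, zero_pow two_ne_zero, mul_zero]
      · have hne : (g i).rootMultiplicity 1 ≠ m := fun h =>
          hi (Finset.mem_filter.2 ⟨Finset.mem_univ _, hc, hg, h⟩)
        have hlt : m + 1 ≤ (g i).rootMultiplicity 1 :=
          Nat.succ_le_of_lt (lt_of_le_of_ne (hmin' i hc hg) (Ne.symm hne))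
        have hdvd1 : (X - C (1 : K)) ^ m * (X - C 1) ∣
            (X - C (1 : K)) ^ m * (g i /ₘ (X - C (1 : K)) ^ m) := by
          rw [hfacg i hc hg, ← pow_succ]
          exact (le_rootMultiplicity_iff hg).1 hlt
        rw [mul_dvd_mul_iff_left hDmonic.ne_zero, dvd_iff_isRoot] at hdvd1
        rw [hdvd1.eq_zero, zero_pow two_ne_zero, mul_zero]

end Summit.ValiantsHypothesis.ValiantsHypothesis.Theorems
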